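import Summits.ResolutionOfSingularities.ResolutionOfSingularities.Theorems.HilbertSamuelEliminationSigmaMaxModificationsCorridor3WLadderIsoTailsArcLimitInclusion
import Literature.RingTheory.HilbertSamuel.NormalFlatnessCriterionDimOne
import Literature.AlgebraicGeometry.Resolution.RsopMonomialIdeals
import Literature.AlgebraicGeometry.Resolution.PowerSeriesRegularLocal
import Mathlib.RingTheory.RegularLocalRing.Defs
import Mathlib.RingTheory.Flat.TorsionFree
import HarnessLib

/-!
# [OURS · L1 W4.2 · D14 ROUTE G v2 «ARC LIMIT» · G2c, file 5] `S/J_∞` is normally flat along the arc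

Sub-problem `ResolutionOfSingularities`, crux `SigmaMaxModifications` / conjunct `SigmaMaxModificationsCorridor3`
(route `HilbertSamuelElimination`, line `w_ladder`), idea chain L1 C5 «K1 FREE-RATIONAL TAILS», ROUTE G v2 (memo
`L/res-L1-w42-lead-1/ROUTE-G-ARCLIMIT.md` 96c77a196e17bc23, §3 (L3) in its library form), over `…IsoTailsArcLimitInclusion`.

* §1 the arc ideal `P₀ = (X_1,…,X_d)` is generated by PART OF A REGULAR SYSTEM OF PARAMETERS of `S = K⟦t, y⟧` (completed by `t`):
  `isRsopPart_X_succ`; hence prime, `S/P₀` regular of dimension `1`, `𝔪_S = P₀ + (t)`;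
* §2 units of `y`-degree `0`: `exists_layer_zero_eq_X_pow_mul_unit` (`layer_0 u = t^k · v`, `v` a unit, for `u ∉ P₀`) and
  `isWeightedHomogeneous_zero_of_isUnit_inv`;
* §3 **TORSION-FREENESS** `mem_sup_limitIdeal_of_mul_mem` (`u ∉ P₀`, `f ∈ P₀^j`, `u f ∈ P₀^{j+1} + J_∞ ⇒ f ∈ P₀^{j+1} + J_∞`) and,
  for `B = S/J_∞`, `𝔓 = P₀ B`: `isTorsionFree_gradedPiece_limit`, **`isNormallyFlat_limit : 𝔓.IsNormallyFlat`** (torsion-free over the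
  discrete valuation ring `B/𝔓 ≅ K⟦t⟧` ⇒ flat);
* §4 the Bennett EQUALITY for `B`: `hilbertFun_limit_eq_hilbertSamuelFun` (tree `hilbertFun_eq_hilbertSamuelFun_of_isNormallyFlat`).

Everything is OURS; no statement of the manuscript under adjudication and no published theorem is asserted.
[cite: HerrmannIkedaOrbanz1988, Thm. (22.24), Prop. (30.1)] [cite: CossartJannsenSaito2020, Thm. 3.3]
-/

set_option linter.dupNamespace false -- mandated namespace of this single-conjunct summit
open MvPowerSeries IsLocalRing
open Finsupp hiding some
open Literature.RingTheory.HilbertSamuel Literature.AlgebraicGeometry.Resolution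

noncomputable section

universe u v

namespace Summit.ResolutionOfSingularities.ResolutionOfSingularities.Cruxes.SigmaMaxModifications.IdeasL1C5

namespace ArcLimit

variable {d : ℕ} {K : Type u} [Field K]

/-! ### §1. `P₀` is generated by part of a regular system of parameters -/

/-- `(X_1, …, X_d)` is part of a regular system of parameters of `K⟦X_0, …, X_d⟧` (completed by `X_0`). [folklore] -/
theorem isRsopPart_X_succ : IsRsopPart (fun i : Fin d => (X i.succ : MvPowerSeries (Fin (d + 1)) K)) := by
  refine ⟨isRegularLocalRing_mvPowerSeries K (Fin (d + 1)), 1, ![X 0], ?_, ?_⟩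
  · rw [ringKrullDim_mvPowerSeries, Nat.card_eq_fintype_card, Fintype.card_fin]
  · apply le_antisymm
    · rw [Ideal.span_le]
      rintro f (⟨i, rfl⟩ | ⟨j, rfl⟩)
      · exact X_mem_maximalIdeal K (Fin (d + 1)) _
      · fin_cases j; exact X_mem_maximalIdeal K (Fin (d + 1)) 0
    · rw [maximalIdeal_mvPowerSeries_eq_span, Ideal.span_le]
      rintro f ⟨i, rfl⟩
      by_cases hi : i = 0
      · subst hi; exact Ideal.subset_span (Or.inr ⟨0, rfl⟩)
      · obtain ⟨j, rfl⟩ := Fin.exists_succ_eq.mpr hi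
        exact Ideal.subset_span (Or.inl ⟨j, rfl⟩)

/-- [OURS · L1 W4.2] `arcIdeal_eq_span_range` — normal-flatness bookkeeping. [folklore] -/
theorem arcIdeal_eq_span_range : arcIdeal d K = Ideal.span (Set.range fun i : Fin d => (X i.succ : MvPowerSeries (Fin (d + 1)) K)) :=
  rfl

/-- `P₀` is prime. [folklore] -/
theorem isPrime_arcIdeal : (arcIdeal d K).IsPrime :=
  isRsopPart_X_succ.isPrime_span_range

/-- `S/P₀` is a regular local ring. [folklore] -/
theorem isRegularLocalRing_quotient_arcIdeal : IsRegularLocalRing (MvPowerSeries (Fin (d + 1)) K ⧸ arcIdeal d K) :=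
  isRsopPart_X_succ.isRegularLocalRing_quotient

/-- `dim S/P₀ = 1`. [folklore] -/
theorem ringKrullDim_quotient_arcIdeal : ringKrullDim (MvPowerSeries (Fin (d + 1)) K ⧸ arcIdeal d K) = 1 := by
  have h := (isRsopPart_X_succ (d := d) (K := K)).ringKrullDim_quotient_add
  rw [ringKrullDim_mvPowerSeries, Nat.card_eq_fintype_card, Fintype.card_fin] at h
  haveI := isRegularLocalRing_quotient_arcIdeal (d := d) (K := K)
  obtain ⟨n, hn⟩ := exists_ringKrullDim_eq_natCast (MvPowerSeries (Fin (d + 1)) K ⧸ arcIdeal d K)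
  rw [← arcIdeal_eq_span_range, hn] at h
  rw [hn]
  have h' : ((n + d : ℕ) : WithBot ℕ∞) = ((d + 1 : ℕ) : WithBot ℕ∞) := by exact_mod_cast h
  have : n + d = d + 1 := by exact_mod_cast h'
  have hn1 : n = 1 := by omega
  subst hn1; rfl

/-- `𝔪_S = P₀ + (t)`. [folklore] -/
theorem maximalIdeal_eq_arcIdeal_sup_span :
    maximalIdeal (MvPowerSeries (Fin (d + 1)) K) = arcIdeal d K ⊔ Ideal.span {X 0} := by
  obtain ⟨-, e, y, -, hspan⟩ := (isRsopPart_X_succ (d := d) (K := K))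
  -- direct computation from `𝔪 = (X_0, …, X_d)`
  apply le_antisymm
  · rw [maximalIdeal_mvPowerSeries_eq_span, Ideal.span_le]
    rintro f ⟨i, rfl⟩
    by_cases hi : i = 0
    · subst hi; exact Ideal.mem_sup_right (Ideal.mem_span_singleton_self _)
    · exact Ideal.mem_sup_left (X_mem_arcIdeal hi)
  · exact sup_le isRsopPart_X_succ.span_range_le_maximalIdeal
      ((Ideal.span_singleton_le_iff_mem _).mpr (X_mem_maximalIdeal K (Fin (d + 1)) 0))

/-- `t ∉ P₀`. [folklore] -/
theorem X_zero_not_mem_arcIdeal : (X 0 : MvPowerSeries (Fin (d + 1)) K) ∉ arcIdeal d K := by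
  intro h
  rw [show arcIdeal d K = arcIdeal d K ^ 1 by rw [pow_one], mem_arcIdeal_pow_iff] at h
  have := h (single 0 1) (by simp)
  rw [coeff_X, if_pos rfl] at this
  exact one_ne_zero this

/-! ### §2. Units of `y`-degree `0` -/

/-- An exponent of `y`-degree `0` is a pure power of `t`. [folklore] -/
theorem eq_single_of_yDeg_eq_zero {e : Fin (d + 1) →₀ ℕ} (he : yDeg e = 0) : e = single 0 (e 0) := by
  ext i
  by_cases hi : i = 0
  · subst hi; simp
  · obtain ⟨j, rfl⟩ := Fin.exists_succ_eq.mpr hi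
    rw [yDeg_eq_sum] at he
    have := Finset.sum_eq_zero_iff.mp he j (Finset.mem_univ j)
    simp [this]

/-- **`layer_0 u = t^k · v` with `v` a unit** for `u ∉ P₀`. [folklore] -/
theorem exists_layer_zero_eq_X_pow_mul_unit {u : MvPowerSeries (Fin (d + 1)) K} (hu : u ∉ arcIdeal d K) :
    ∃ (k : ℕ) (v : MvPowerSeries (Fin (d + 1)) K), IsUnit v ∧ IsWeightedHomogeneous (yW d) v 0 ∧
      layer 0 u = X 0 ^ k * v := by
  classical
  have hex : ∃ a : ℕ, coeff (single (0 : Fin (d + 1)) a) u ≠ 0 := by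
    by_contra h
    push Not at h
    apply hu
    rw [show arcIdeal d K = arcIdeal d K ^ 1 by rw [pow_one], mem_arcIdeal_pow_iff]
    intro e he
    rw [eq_single_of_yDeg_eq_zero (by omega : yDeg e = 0)]
    exact h _
  let k := Nat.find hex
  have hk : coeff (single (0 : Fin (d + 1)) k) u ≠ 0 := Nat.find_spec hex
  have hmin : ∀ a < k, coeff (single (0 : Fin (d + 1)) a) u = 0 := fun a ha => by
    have := Nat.find_min hex ha; simpa using this
  let v : MvPowerSeries (Fin (d + 1)) K := fun e => if yDeg e = 0 then coeff (e + single 0 k) u else 0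
  have hv : ∀ e, coeff e v = if yDeg e = 0 then coeff (e + single 0 k) u else 0 := fun e => rfl
  refine ⟨k, v, ?_, fun {e} he => ?_, ?_⟩
  · rw [MvPowerSeries.isUnit_iff_constantCoeff, ← coeff_zero_eq_constantCoeff_apply, hv,
      if_pos (show yDeg (0 : Fin (d + 1) →₀ ℕ) = 0 from map_zero _), zero_add]
    exact isUnit_iff_ne_zero.mpr hk
  · by_contra hne
    apply he
    show (if yDeg e = 0 then coeff (e + single 0 k) u else 0) = 0
    exact if_neg hne
  · ext e
    rw [coeff_layer, X_pow_eq, coeff_monomial_mul, one_mul]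
    by_cases hle : single 0 k ≤ e
    · rw [if_pos hle, hv]
      have hydeg : yDeg (e - single 0 k) = yDeg e := by
        have := congrArg yDeg (tsub_add_cancel_of_le hle)
        rw [yDeg_add, yDeg_single_zero, add_zero] at this
        exact this
      rw [hydeg, tsub_add_cancel_of_le hle]
    · rw [if_neg hle]
      split_ifs with hy
      · have he := eq_single_of_yDeg_eq_zero hy
        have hlt : e 0 < k := by
          by_contra hge
          push Not at hge
          exact hle (by rw [he, single_le_iff]; simpa using hge)
        rw [he]
        exact hmin _ hlt
      · rfl

/-- The inverse of a unit of `y`-degree `0` has `y`-degree `0`. [folklore] -/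
theorem isWeightedHomogeneous_zero_of_isUnit_inv {v : MvPowerSeries (Fin (d + 1)) K} (hv : IsUnit v)
    (hv0 : IsWeightedHomogeneous (yW d) v 0) : IsWeightedHomogeneous (yW d) (↑hv.unit⁻¹ : MvPowerSeries (Fin (d + 1)) K) 0 := by
  set w : MvPowerSeries (Fin (d + 1)) K := ↑hv.unit⁻¹ with hw
  have hvw : v * w = 1 := by rw [hw]; exact hv.mul_val_inv
  -- `layer_0 (v w) = v · layer_0 w = 1`, so `layer_0 w = w`
  have h1w : IsWeightedHomogeneous (yW d) (1 : MvPowerSeries (Fin (d + 1)) K) 0 := by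
    intro e he
    rw [coeff_one] at he
    by_cases h : e = 0
    · rw [h]; exact map_zero _
    · exact absurd (if_neg h) he
  have h1 : v * layer 0 w = 1 := by
    rw [← layer_mul_of_isWeightedHomogeneous_zero 0 w hv0, hvw]
    exact layer_eq_self_of_isWeightedHomogeneous h1w
  have h2 : layer 0 w = w := by
    have h3 : w * (v * layer 0 w) = w * 1 := by rw [h1]
    rw [← mul_assoc, mul_comm w v, hvw, one_mul, mul_one] at h3
    exact h3
  rw [← h2]
  exact @isWeightedHomogeneous_layer d K _ 0 w

/-! ### §3. Torsion-freeness and normal flatness of `S/J_∞` along `P₀` -/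

/-- **`u ∉ P₀`, `f ∈ P₀^j`, `u·f ∈ P₀^{j+1} + J_∞ ⇒ f ∈ P₀^{j+1} + J_∞`.** [folklore] -/
theorem mem_sup_limitIdeal_of_mul_mem {J : Ideal (MvPowerSeries (Fin (d + 1)) K)} {j : ℕ}
    {u f : MvPowerSeries (Fin (d + 1)) K} (hu : u ∉ arcIdeal d K) (hf : f ∈ arcIdeal d K ^ j)
    (h : u * f ∈ arcIdeal d K ^ (j + 1) ⊔ limitIdeal J) : f ∈ arcIdeal d K ^ (j + 1) ⊔ limitIdeal J := by
  obtain ⟨k, v, hvu, hv0, hkv⟩ := exists_layer_zero_eq_X_pow_mul_unit hu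
  -- `layer_j (u f) = layer_0 u · layer_j f`
  have hlay : layer j (u * f) = layer 0 u * layer j f := by
    rw [layer_mul_sum]
    rw [Finset.sum_eq_single_of_mem j (by simp)]
    · rw [Nat.sub_self]
    · intro i hi hij
      rw [Finset.mem_range] at hi
      rw [layer_eq_zero_of_mem_pow hf (by omega), mul_zero]
  -- it is a saturated initial form
  obtain ⟨q, hq, r, hr, hqr⟩ := Submodule.mem_sup.mp h
  have hsat : layer 0 u * layer j f ∈ satLayer J j := by
    rw [← hlay, ← hqr, map_add, layer_eq_zero_of_mem_pow_succ le_rfl hq, zero_add]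
    exact layer_mem_satLayer_of_mem_limitIdeal hr j
  rw [hkv, mul_assoc] at hsat
  have hhom : IsWeightedHomogeneous (yW d) (v * layer j f) j := by
    have h0j : IsWeightedHomogeneous (yW d) (v * layer j f) (0 + j) :=
      IsWeightedHomogeneous.mul hv0 (isWeightedHomogeneous_layer j f)
    rwa [zero_add] at h0j
  have hvL : v * layer j f ∈ satLayer J j := mem_satLayer_of_X_pow_mul_mem hhom hsat
  have hL : layer j f ∈ satLayer J j := by
    have := mul_mem_satLayer (isWeightedHomogeneous_zero_of_isUnit_inv hvu hv0) hvL
    rwa [← mul_assoc, IsUnit.val_inv_mul, one_mul, zero_add] at this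
  have : f = (f - layer j f) + layer j f := by ring
  rw [this]
  exact Submodule.add_mem_sup (sub_layer_mem_arcIdeal_pow_succ hf) (mem_limitIdeal_of_mem_satLayer hL)

section Quotient

variable (J : Ideal (MvPowerSeries (Fin (d + 1)) K)) (hJ : J ≤ arcIdeal d K)

/-- The arc prime of the limit ring `B = S/J_∞`: `𝔓 = P₀ · B`. [folklore] -/
abbrev limitPrime : Ideal (MvPowerSeries (Fin (d + 1)) K ⧸ limitIdeal J) :=
  (arcIdeal d K).map (Ideal.Quotient.mk (limitIdeal J))

include hJ in
/-- [OURS · L1 W4.2] `limitIdeal_le` — normal-flatness bookkeeping. [folklore] -/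
theorem limitIdeal_le : limitIdeal J ≤ arcIdeal d K := limitIdeal_le_arcIdeal hJ

include hJ in
/-- [OURS · L1 W4.2] `limitIdeal_ne_top` — normal-flatness bookkeeping. [folklore] -/
theorem limitIdeal_ne_top : limitIdeal J ≠ ⊤ := fun h =>
  isPrime_arcIdeal.ne_top (top_le_iff.mp (h ▸ limitIdeal_le J hJ))

include hJ in
/-- `B = S/J_∞` is a local ring. [folklore] -/
theorem isLocalRing_limit : IsLocalRing (MvPowerSeries (Fin (d + 1)) K ⧸ limitIdeal J) :=
  haveI : Nontrivial (MvPowerSeries (Fin (d + 1)) K ⧸ limitIdeal J) :=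
    Ideal.Quotient.nontrivial_iff.mpr (limitIdeal_ne_top J hJ)
  IsLocalRing.of_surjective' (Ideal.Quotient.mk _) Ideal.Quotient.mk_surjective

include hJ in
/-- `𝔓` is prime. [folklore] -/
theorem isPrime_limitPrime : (limitPrime J).IsPrime :=
  Ideal.map_isPrime_of_surjective Ideal.Quotient.mk_surjective (by rw [Ideal.mk_ker]; exact limitIdeal_le J hJ)
    (H := isPrime_arcIdeal)

include hJ in
/-- `B/𝔓 ≅ S/P₀`. [folklore] -/
def limitQuotEquiv : (MvPowerSeries (Fin (d + 1)) K ⧸ limitIdeal J) ⧸ limitPrime J ≃+* MvPowerSeries (Fin (d + 1)) K ⧸ arcIdeal d K :=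
  DoubleQuot.quotQuotEquivQuotOfLE (limitIdeal_le J hJ)

include hJ in
/-- [OURS · L1 W4.2] `isRegularLocalRing_limit_quot` — normal-flatness bookkeeping. [folklore] -/
theorem isRegularLocalRing_limit_quot : IsRegularLocalRing ((MvPowerSeries (Fin (d + 1)) K ⧸ limitIdeal J) ⧸ limitPrime J) :=
  haveI := isRegularLocalRing_quotient_arcIdeal (d := d) (K := K)
  IsRegularLocalRing.of_ringEquiv (limitQuotEquiv J hJ).symm

include hJ in
/-- [OURS · L1 W4.2] `ringKrullDim_limit_quot` — normal-flatness bookkeeping. [folklore] -/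
theorem ringKrullDim_limit_quot : ringKrullDim ((MvPowerSeries (Fin (d + 1)) K ⧸ limitIdeal J) ⧸ limitPrime J) = 1 := by
  rw [ringKrullDim_eq_of_ringEquiv (limitQuotEquiv J hJ), ringKrullDim_quotient_arcIdeal]

/-- `𝔪_B = 𝔓 + (t̄)`. [folklore] -/
theorem maximalIdeal_limit_eq [IsLocalRing (MvPowerSeries (Fin (d + 1)) K ⧸ limitIdeal J)] :
    maximalIdeal (MvPowerSeries (Fin (d + 1)) K ⧸ limitIdeal J) =
      limitPrime J ⊔ Ideal.span {Ideal.Quotient.mk (limitIdeal J) (X 0)} := by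
  rw [← map_maximalIdeal_of_surjective (Ideal.Quotient.mk (limitIdeal J)) Ideal.Quotient.mk_surjective,
    maximalIdeal_eq_arcIdeal_sup_span, Ideal.map_sup, Ideal.map_span, Set.image_singleton]

include hJ in
/-- [OURS · L1 W4.2] `limitPrime_ne_maximalIdeal` — normal-flatness bookkeeping. [folklore] -/
theorem limitPrime_ne_maximalIdeal [IsLocalRing (MvPowerSeries (Fin (d + 1)) K ⧸ limitIdeal J)] :
    limitPrime J ≠ maximalIdeal (MvPowerSeries (Fin (d + 1)) K ⧸ limitIdeal J) := by
  intro h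
  have hX : Ideal.Quotient.mk (limitIdeal J) (X 0) ∈ limitPrime J := by
    rw [h, maximalIdeal_limit_eq J]
    exact Ideal.mem_sup_right (Ideal.mem_span_singleton_self _)
  change _ ∈ (arcIdeal d K).map _ at hX
  rw [Ideal.mem_quotient_iff_mem (limitIdeal_le J hJ)] at hX
  exact X_zero_not_mem_arcIdeal hX

/-- **The graded pieces `𝔓^t/𝔓^{t+1}` of `B = S/J_∞` are torsion-free over `B/𝔓`.** [folklore] -/
theorem isTorsionFree_gradedPiece_limit [hP : (limitPrime J).IsPrime] (t : ℕ) :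
    Module.IsTorsionFree ((MvPowerSeries (Fin (d + 1)) K ⧸ limitIdeal J) ⧸ limitPrime J) (gradedPiece (limitPrime J) t) := by
  haveI : Nontrivial ((MvPowerSeries (Fin (d + 1)) K ⧸ limitIdeal J) ⧸ limitPrime J) :=
    Ideal.Quotient.nontrivial_iff.mpr hP.ne_top
  refine ⟨fun r hr => ?_⟩
  obtain ⟨r₀, rfl⟩ := Ideal.Quotient.mk_surjective r
  obtain ⟨u, rfl⟩ := Ideal.Quotient.mk_surjective r₀
  have hu : u ∉ arcIdeal d K := fun hmem => by
    have h0 : Ideal.Quotient.mk (limitPrime J) (Ideal.Quotient.mk (limitIdeal J) u) = 0 :=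
      Ideal.Quotient.eq_zero_iff_mem.mpr (Ideal.mem_map_of_mem (Ideal.Quotient.mk (limitIdeal J)) hmem)
    rw [h0] at hr
    exact not_isRegular_zero (R := (MvPowerSeries (Fin (d + 1)) K ⧸ limitIdeal J) ⧸ limitPrime J) hr
  have key : ∀ z : gradedPiece (limitPrime J) t,
      Ideal.Quotient.mk (limitPrime J) (Ideal.Quotient.mk (limitIdeal J) u) • z = 0 → z = 0 := by
    intro z hz
    obtain ⟨w, rfl⟩ := gradedPiece.mk_surjective _ t z
    have hz' : gradedPiece.mk (limitPrime J) t (Ideal.Quotient.mk (limitIdeal J) u • w) = 0 := by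
      rw [map_smul]; exact hz
    rw [gradedPiece.mk_eq_zero_iff] at hz' ⊢
    change Ideal.Quotient.mk (limitIdeal J) u * (w : _ ⧸ limitIdeal J) ∈ limitPrime J ^ (t + 1) at hz'
    -- lift `w` to `f ∈ P₀^t`
    obtain ⟨w, hw⟩ := w
    have hw' : w ∈ (arcIdeal d K ^ t).map (Ideal.Quotient.mk (limitIdeal J)) := by
      rw [Ideal.map_pow]; exact hw
    rw [Ideal.mem_map_iff_of_surjective _ Ideal.Quotient.mk_surjective] at hw'
    obtain ⟨f, hf, rfl⟩ := hw'
    have hz'' : u * f ∈ arcIdeal d K ^ (t + 1) ⊔ limitIdeal J := by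
      rw [← Ideal.mem_quotient_iff_mem_sup, map_mul, Ideal.map_pow]; exact hz'
    change Ideal.Quotient.mk (limitIdeal J) f ∈ limitPrime J ^ (t + 1)
    have hgoal := mem_sup_limitIdeal_of_mul_mem hu hf hz''
    rw [← Ideal.mem_quotient_iff_mem_sup, Ideal.map_pow] at hgoal
    exact hgoal
  intro x y hxy
  have h0 : Ideal.Quotient.mk (limitPrime J) (Ideal.Quotient.mk (limitIdeal J) u) • (x - y) = 0 := by
    rw [smul_sub, sub_eq_zero]; exact hxy
  exact sub_eq_zero.mp (key _ h0)

/-- **`B = S/J_∞` IS NORMALLY FLAT ALONG `𝔓 = P₀ B`** (torsion-free graded pieces over the discrete valuation ring `B/𝔓 ≅ K⟦t⟧` are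
flat). [cite: HerrmannIkedaOrbanz1988, Thm. (22.24)] -/
theorem isNormallyFlat_limit [IsLocalRing (MvPowerSeries (Fin (d + 1)) K ⧸ limitIdeal J)] [(limitPrime J).IsPrime] :
    (limitPrime J).IsNormallyFlat := by
  haveI : IsNoetherianRing (MvPowerSeries (Fin (d + 1)) K) := isNoetherianRing_mvPowerSeries K (Fin (d + 1))
  haveI : IsNoetherianRing (MvPowerSeries (Fin (d + 1)) K ⧸ limitIdeal J) :=
    Ideal.Quotient.isNoetherianRing _
  intro t
  haveI : IsPrincipalIdealRing ((MvPowerSeries (Fin (d + 1)) K ⧸ limitIdeal J) ⧸ limitPrime J) :=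
    isPrincipalIdealRing_quotient_of_sup_span_eq (limitPrime J) (maximalIdeal_limit_eq J)
  haveI : IsDedekindDomain ((MvPowerSeries (Fin (d + 1)) K ⧸ limitIdeal J) ⧸ limitPrime J) :=
    IsPrincipalIdealRing.isDedekindDomain _
  have htf := (Submodule.isTorsionFree_iff_torsion_eq_bot
    (R := (MvPowerSeries (Fin (d + 1)) K ⧸ limitIdeal J) ⧸ limitPrime J) (M := gradedPiece (limitPrime J) t)).mp
    (isTorsionFree_gradedPiece_limit J t)
  exact (IsDedekindDomain.flat_iff_torsion_eq_bot
    (R := (MvPowerSeries (Fin (d + 1)) K ⧸ limitIdeal J) ⧸ limitPrime J) (M := gradedPiece (limitPrime J) t)).mpr htf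

/-! ### §4. Bennett's equality for `B = S/J_∞` -/

include hJ in
/-- **`H^{(0)}[S/J_∞] = H^{(1)}[(S/J_∞)_𝔓]`** for every localisation at `𝔓` (tree: normal flatness ⇒ Bennett equality).
[cite: HerrmannIkedaOrbanz1988, Cor. (21.12), Thm. (22.24)] [cite: CossartJannsenSaito2020, Thm. 3.3] -/
theorem hilbertFun_limit_eq_hilbertSamuelFun [IsLocalRing (MvPowerSeries (Fin (d + 1)) K ⧸ limitIdeal J)]
    (Rp : Type v) [CommRing Rp] [Algebra (MvPowerSeries (Fin (d + 1)) K ⧸ limitIdeal J) Rp]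
    [hP : (limitPrime J).IsPrime] [IsLocalization.AtPrime Rp (limitPrime J)] [IsLocalRing Rp] :
    hilbertFun (MvPowerSeries (Fin (d + 1)) K ⧸ limitIdeal J) = hilbertSamuelFun Rp 1 := by
  haveI : IsNoetherianRing (MvPowerSeries (Fin (d + 1)) K) := isNoetherianRing_mvPowerSeries K (Fin (d + 1))
  haveI : IsNoetherianRing (MvPowerSeries (Fin (d + 1)) K ⧸ limitIdeal J) := Ideal.Quotient.isNoetherianRing _
  haveI := isRegularLocalRing_limit_quot J hJ
  exact hilbertFun_eq_hilbertSamuelFun_of_isNormallyFlat (limitPrime J) Rp (ringKrullDim_limit_quot J hJ)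
    (isNormallyFlat_limit J)

end Quotient

end ArcLimit

end Summit.ResolutionOfSingularities.ResolutionOfSingularities.Cruxes.SigmaMaxModifications.IdeasL1C5

end
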